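import Summits.ResolutionOfSingularities.ResolutionOfSingularities.Theorems.PinchTowerStage

/-!
# MaxContactCut / PinchTower (P8/8) — ENGINE (M) `MonomialPinchExit` PROVED with no hypothesis; the 16-engine
corollary `ConeJump.cuspGenericRung_of_engines` with the binder `hM : MonomialPinchExit` DISCHARGED (15 left)

Node «PinchTower» of cell `decomp-res-lens-2` (RESIDUAL MODE, lens «structural dichotomy (special vs generic)», g31),
by-name target `MaxContactCut.RungOne` via the landed `CuspX.closes : CuspX.CuspGenericRung → CuspX.CuspSpecialRung →
MaxContactCut.RungOne` and `ConeJump.cuspGenericRung_of_engines` (16 engine binders).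

THE LETTER.  `PinchCut.MonomialPinchExit`: on a regular scheme `Y`, a curve `cl{η}` at whose closed points `y` the
ideal has the PINCH FRAME `c₀ⁿ + λ vᵏ c₁ᵐ + g ∈ 𝓘_y ⊆ Q(mn)`, `g ∈ Q(mn + 1)` (`(c₀, c₁) = 𝔓` the curve prime,
`(c₀, c₁, v) = 𝔪_y`, `λ` a unit, `2 ≤ n ≤ m`) with the EXIT CONDITION `PinchExitCond κ(y) n k m λ̄`, has an exit
package over `{y | η ⤳ y}`: a weakly admissible sequence of regular centres over the curve after which Hironaka's
`τ ≥ 2` at every order-`n` point over the curve.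

THE MECHANISM (special vs generic, twice).  (1) THE PINCH SHAPE `zⁿ + uᵃ·λvᵏ + g` (P4 `PinchShape`, weight `a`,
`g ∈ Q'(na + 1)`, `𝓘 ⊆ Q'(na)`, exit condition carried in `κ`) is STABLE under the blow-up of its Σ-pair `(z, u)`:
the `z`-chart and the `u`-chart off the origin are resolved (`(1)`) or — exactly at `a = n`, `k = 0` — of order `< n`,
by the FIBRE ARGUMENT over `κ(x)[X]` (`1 + λ̄Xⁿ`, `Xⁿ + λ̄` in `s⁻¹𝔫ⁿ` force `λ̄` to be a cone power, P3), and the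
`u`-origin is a pinch shape of weight `a - n` with the SAME `λ, v, k` read in the new regular parameters
`(e₀, t, σv)` and the same residue field (P5).  (2) THE TOWER (P7 `pinchStage`, recursion on `a`): blow up the curve
(`a = m`), then the surfaces `Σ = V(√(𝓘 + 𝓔))` while `a ≥ n`; at `a < n` the order-`n` points are pinch-shape
points and `PinchShape.exit` (P4) gives `τ ≥ 2` — generic `k + a ≤ n` by the PINCH ORDER BOUND (P1) and a direct
directrix computation (P2), special `k ∈ {0, n}`, `a = 0`, `λ̄` not a cone power by `two_le_hironakaTau_pinchForm`
(P4: `X₀ⁿ + λ̄X₂ⁿ + X₁H` has `τ ≥ 2` unless `λ̄` is a cone power).  (3) THE GENERIC POINT `η` is a pinch-shape point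
of `𝒪_η` in its own right (P6 `pinchShape_eta`): `λvᵏ` is a unit there and `λ̄ v̄ᵏ ∈ κ(η) = Frac(𝒪_{y₀}/𝔓)` is not
a cone power (`not_isConePower_frac`, P3) — so NO semicontinuity and NO properness enter.

Slices: P1 `PinchTowerAlg` · P2 `PinchTowerTau` · P3 `PinchTowerCone` · P4 `PinchTowerShape` · P5 `PinchTowerChart` ·
P6 `PinchTowerFrame` · P7 `PinchTowerStage` · P8 this file (§8 the curve blow-up and the main theorem, §9 corollaries).
Sources: [Hironaka1964] Ch. III; [CossartJannsenSaito2020] Ch. 2, 8, 9; [CossartPiltant2008] §4; [CutkoskyBook2004] §7;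
[Matsumura1987] Thms. 14.2, 16.2.
-/

open IsLocalRing
open Literature.AlgebraicGeometry.Resolution
open Summit.ResolutionOfSingularities.ResolutionOfSingularities.Theorems.DeltaFaceCutClasses (qWeighted)
open Summit.ResolutionOfSingularities.ResolutionOfSingularities.Theorems.TowerCut
open Summit.ResolutionOfSingularities.ResolutionOfSingularities.Theorems.PinchCut

namespace Summit.ResolutionOfSingularities.ResolutionOfSingularities.Theorems.PinchTower

/-! ## §8  The curve blow-up and the main theorem -/

section SchemeLevel

open CategoryTheory AlgebraicGeometry TopologicalSpace Topology
open Summit.ResolutionOfSingularities.ResolutionOfSingularities.Theorems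
open Summit.ResolutionOfSingularities.ResolutionOfSingularities.Theorems.WeakOrderReduction
open Summit.ResolutionOfSingularities.ResolutionOfSingularities.Theorems.RelativeDeltaCut

variable {Y : Scheme.{0}}

/-- **Over a CLOSED point of the curve** the curve blow-up propagates the pinch shape: `(1)`, or (`m = n` and)
order `< n`, or a pinch shape of weight `m - n`. [folklore] -/
theorem pinchInv_closed [IsLocallyNoetherian Y] (hY : Scheme.IsRegular Y) (C₀ I : Y.IdealSheafData)
    {n m : ℕ} (hn : 1 ≤ n) (hnm : n ≤ m) {η : Y} (hC : ∀ (y : Y) (h : η ⤳ y), stalkIdeal C₀ y = curvePrime h)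
    (x' : ↑(blowup C₀)) (hpt : IsPinchAt I n m η (blowup.π C₀ x')) :
    stalkIdeal (controlledTransform (blowup.π C₀) C₀ I n) x' = ⊤ ∨
      (m - n < n ∧ ¬ stalkIdeal (controlledTransform (blowup.π C₀) C₀ I n) x' ≤ maximalIdeal _ ^ n) ∨
      Nonempty (PinchShape (stalkIdeal (controlledTransform (blowup.π C₀) C₀ I n) x')
        (stalkIdeal (C₀.comap (blowup.π C₀)) x') n (m - n)) := by
  obtain ⟨h, E, D, hc⟩ := pinchShape_of_isPinchAt hY I hpt
  exact D.blowupInv hY C₀ I hn hnm x' (by rw [hc, hC _ h])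

/-- **Over the GENERIC point `η`** the same trichotomy, from the pinch shape of `𝒪_η` (`pinchShape_eta`). [folklore] -/
theorem pinchInv_eta [IsLocallyNoetherian Y] (hY : Scheme.IsRegular Y) (C₀ I : Y.IdealSheafData)
    {n m : ℕ} (hn : 1 ≤ n) (hnm : n ≤ m) {η y₀ : Y} (hy₀η : y₀ ≠ η)
    (hCη : stalkIdeal C₀ η = maximalIdeal (Y.presheaf.stalk η)) (hpt : IsPinchAt I n m η y₀)
    (x' : ↑(blowup C₀)) (hx' : blowup.π C₀ x' = η) :
    stalkIdeal (controlledTransform (blowup.π C₀) C₀ I n) x' = ⊤ ∨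
      (m - n < n ∧ ¬ stalkIdeal (controlledTransform (blowup.π C₀) C₀ I n) x' ≤ maximalIdeal _ ^ n) ∨
      Nonempty (PinchShape (stalkIdeal (controlledTransform (blowup.π C₀) C₀ I n) x')
        (stalkIdeal (C₀.comap (blowup.π C₀)) x') n (m - n)) := by
  subst hx'
  obtain ⟨E, D, hc⟩ := pinchShape_eta hY C₀ I hn hy₀η hCη hpt
  exact D.blowupInv hY C₀ I hn hnm x' hc

/-- **ENGINE (M) `MonomialPinchExit` — PROVED.**  On a regular scheme, a uniform pinch curve `cl{η}` of order `n ≥ 2`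
and degree `m ≥ n` has an exit package with centres over it: the curve blow-up followed by the surface blow-ups of the
pinch tower; every centre is regular and inside `supp(𝓘, n)`, and at every point of order `n` over the curve after the
tower Hironaka's `τ ≥ 2`. [folklore] -/
theorem monomialPinchExit_holds : MonomialPinchExit := by
  intro Y hY I n hn η m hnm hU hLN
  obtain ⟨hcurve, hpinch⟩ := hU
  haveI : IsLocallyNoetherian Y := hLN
  -- a closed point of the curve
  obtain ⟨y₀, hy₀, hy₀η⟩ : ∃ y₀ : Y, η ⤳ y₀ ∧ y₀ ≠ η := by
    by_contra hcon
    push Not at hcon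
    refine hcurve.1 ?_
    have hcl : closure ({η} : Set Y) = {η} := by
      refine Set.Subset.antisymm (fun y hy => ?_) subset_closure
      exact hcon y (specializes_iff_mem_closure.mpr hy)
    rw [← hcl]
    exact isClosed_closure
  have hy₀c : IsClosed ({y₀} : Set Y) := hcurve.2 y₀ hy₀ hy₀η
  -- the curve centre `C₀ = 𝓘(cl{η})`
  set C0 : Y.IdealSheafData :=
    Scheme.IdealSheafData.vanishingIdeal (⟨closure ({η} : Set Y), isClosed_closure⟩ : Closeds Y) with hC0def
  have hC0supp : ∀ y : Y, y ∈ (C0.support : Set Y) ↔ η ⤳ y := fun y => by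
    rw [hC0def, coe_support_vanishingIdeal, specializes_iff_mem_closure]
    rfl
  have hC0st : ∀ (y : Y) (h : η ⤳ y), stalkIdeal C0 y = curvePrime h := fun y h => by
    rw [hC0def, stalkIdeal_vanishingIdeal_closure h]
    rfl
  have hC0η : stalkIdeal C0 η = maximalIdeal _ := by
    rw [hC0def]; exact stalkIdeal_vanishingIdeal_closure_self η
  have hC0reg : Scheme.IsRegular C0.subscheme := isRegular_pinchCurve_subscheme hY I ⟨hcurve, hpinch⟩
  have hsuppT : (C0.support : Set Y) ⊆ {y | η ⤳ y} := fun y hy => (hC0supp y).mp hy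
  have hsuppM : (C0.support : Set Y) ⊆ (⟨I, [], n⟩ : MarkedIdeal Y).support := by
    intro y hy
    have h : η ⤳ y := (hC0supp y).mp hy
    rw [MarkedIdeal.mem_support_iff]
    change stalkIdeal I y ≤ maximalIdeal _ ^ n
    by_cases hyc : IsClosed ({y} : Set Y)
    · obtain ⟨h', hle, hPm⟩ := pinch_stalkIdeal_le I (by omega) hnm (hpinch y h hyc)
      exact hle.trans (Ideal.pow_right_mono hPm n)
    · have hyη : y = η := by
        by_contra hne
        exact hyc (hcurve.2 y h hne)
      subst hyη
      obtain ⟨h', hle, -⟩ := pinch_stalkIdeal_le I (by omega) hnm (hpinch y₀ hy₀ hy₀c)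
      rw [← stalkIdeal_map_stalkSpecializes I h']
      refine (Ideal.map_mono hle).trans ?_
      rw [Ideal.map_pow]
      exact Ideal.pow_right_mono Ideal.map_comap_le n
  -- the blow-up `Y₁ → Y` of the curve is regular
  haveI := CentreSeq.isLocallyNoetherian_blowup C0
  have hY₁ : Scheme.IsRegular ↑(blowup C0) :=
    IsBlowup.isRegular_of_isRegular_subscheme hY hC0reg (blowup.isBlowup C0)
  -- the stage invariant on `Y₁` over the curve, weight `a = m - n`
  have hinv : ∀ x' ∈ blowup.π C0 ⁻¹' {y | η ⤳ y},
      stalkIdeal ((⟨I, [], n⟩ : MarkedIdeal Y).transform (blowup.π C0) C0).ideal x' = ⊤ ∨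
        (m - n < ((⟨I, [], n⟩ : MarkedIdeal Y).transform (blowup.π C0) C0).mult ∧
          ¬ stalkIdeal ((⟨I, [], n⟩ : MarkedIdeal Y).transform (blowup.π C0) C0).ideal x' ≤
            maximalIdeal _ ^ ((⟨I, [], n⟩ : MarkedIdeal Y).transform (blowup.π C0) C0).mult) ∨
        Nonempty (PinchShape (stalkIdeal ((⟨I, [], n⟩ : MarkedIdeal Y).transform (blowup.π C0) C0).ideal x')
          (stalkIdeal (C0.comap (blowup.π C0)) x')
          ((⟨I, [], n⟩ : MarkedIdeal Y).transform (blowup.π C0) C0).mult (m - n)) := by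
    intro x' hx'
    have hηx : η ⤳ blowup.π C0 x' := hx'
    change stalkIdeal (controlledTransform (blowup.π C0) C0 I n) x' = ⊤ ∨
      (m - n < n ∧ ¬ stalkIdeal (controlledTransform (blowup.π C0) C0 I n) x' ≤ maximalIdeal _ ^ n) ∨
      Nonempty (PinchShape (stalkIdeal (controlledTransform (blowup.π C0) C0 I n) x')
        (stalkIdeal (C0.comap (blowup.π C0)) x') n (m - n))
    by_cases hcl : IsClosed ({blowup.π C0 x'} : Set Y)
    · exact pinchInv_closed hY C0 I (by omega) hnm hC0st x' (hpinch _ hηx hcl)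
    · have hπη : blowup.π C0 x' = η := by
        by_contra hne
        exact hcl (hcurve.2 _ hηx hne)
      exact pinchInv_eta hY C0 I (by omega) hnm hy₀η hC0η (hpinch y₀ hy₀ hy₀c) x' hπη
  -- run the pinch tower
  have hTE : ((C0.comap (blowup.π C0)).support : Set _) ⊆ blowup.π C0 ⁻¹' {y | η ⤳ y} := fun x' hx' =>
    hsuppT ((mem_support_comap_iff _ _ x').mp hx')
  obtain ⟨rest, hwa, hco, hT, hexit⟩ := pinchStage (m - n) hY₁
    ((⟨I, [], n⟩ : MarkedIdeal Y).transform (blowup.π C0) C0) (C0.comap (blowup.π C0))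
    (blowup.π C0 ⁻¹' {y | η ⤳ y}) hn hTE hinv
  refine ⟨CentreSeq.cons C0 rest, ⟨hsuppM, hC0reg, hwa⟩, ⟨hsuppT, hco⟩, hT, fun x hx hord => ?_⟩
  have hx' : rest.comp x ∈ blowup.π C0 ⁻¹' {y | η ⤳ y} := hx
  have hord' : ((n : ℕ) : ℕ∞) ≤ idealOrder ((CentreSeq.cons C0 rest).transformMarked ⟨I, [], n⟩).ideal x :=
    le_of_eq hord.symm
  simpa [CentreSeq.transformMarked_cons] using
    hexit x hx' (by simpa [CentreSeq.transformMarked_cons] using hord')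

end SchemeLevel

/-! ## §9  DISCHARGE COROLLARY: the landed 16-engine corollary `ConeJump.cuspGenericRung_of_engines` with the binder
`hM : MonomialPinchExit` removed BY NAME (15 engine binders left) -/

section Corollaries

open Summit.ResolutionOfSingularities.ResolutionOfSingularities.Theorems
open Summit.ResolutionOfSingularities.ResolutionOfSingularities.Theorems.WeakOrderReduction
open Summit.ResolutionOfSingularities.ResolutionOfSingularities.Theorems.DeltaFaceCutClasses
open Summit.ResolutionOfSingularities.ResolutionOfSingularities.Theorems.RelativeDeltaCut
open Summit.ResolutionOfSingularities.ResolutionOfSingularities.Theorems.FaceFormCutClasses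
open Summit.ResolutionOfSingularities.ResolutionOfSingularities.Theorems.CurveLeafExit
open Summit.ResolutionOfSingularities.ResolutionOfSingularities.Theorems.PinchCut
open Summit.ResolutionOfSingularities.ResolutionOfSingularities.Theorems.JetCut
open Summit.ResolutionOfSingularities.ResolutionOfSingularities.Theorems.PurityCut
open Summit.ResolutionOfSingularities.ResolutionOfSingularities.Theorems.SplitCut
open Summit.ResolutionOfSingularities.ResolutionOfSingularities.Theorems.CylinderCut
open Summit.ResolutionOfSingularities.ResolutionOfSingularities.Theorems.CrossCut
open Summit.ResolutionOfSingularities.ResolutionOfSingularities.Theorems.DeepCrossCut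
open Summit.ResolutionOfSingularities.ResolutionOfSingularities.Theorems.OddCrossCut
open Summit.ResolutionOfSingularities.ResolutionOfSingularities.Theorems.CuspCut
open Summit.ResolutionOfSingularities.ResolutionOfSingularities.Theses

/-- **`CuspX.CuspGenericRung` FROM FIFTEEN ENGINES** — the landed `ConeJump.cuspGenericRung_of_engines`
(16 engine binders) with its binder `hM : MonomialPinchExit` DISCHARGED by `monomialPinchExit_holds`. [folklore] -/
theorem cuspGenericRung_of_engines (hV : VeryNearCutClasses.VeryNearExit) (hD : DeltaPackageExit)
    (hU : UniformCurvePackageExit) (hR : RelCurvePackageExit) (hC : FlatConeExit)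
    (hGE : GrandExit) (hSE : SplitConeExit) (hJE : JetCylinderExit)
    (hX : MaxContactCut.MaxOrderThreefoldResolution) (hXE : CrossExit) (hDXE : DeepCrossExit) (hNE : NodeExit)
    (hOXE : OddCrossExit) (hCuE : CuspExit) (hTaE : TameTwoExit) : CuspX.CuspGenericRung :=
  ConeJump.cuspGenericRung_of_engines hV hD hU hR monomialPinchExit_holds hC hGE hSE hJE hX hXE hDXE hNE hOXE
    hCuE hTaE

/-- **`MaxContactCut.RungOne` BY NAME from fifteen engines and the located residual `CuspX.CuspSpecialRung`**
(`CuspX.closes`, cited, not re-landed). [folklore] -/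
theorem closes_of_engines (hV : VeryNearCutClasses.VeryNearExit) (hD : DeltaPackageExit)
    (hU : UniformCurvePackageExit) (hR : RelCurvePackageExit) (hC : FlatConeExit)
    (hGE : GrandExit) (hSE : SplitConeExit) (hJE : JetCylinderExit)
    (hX : MaxContactCut.MaxOrderThreefoldResolution) (hXE : CrossExit) (hDXE : DeepCrossExit) (hNE : NodeExit)
    (hOXE : OddCrossExit) (hCuE : CuspExit) (hTaE : TameTwoExit) (hS : CuspX.CuspSpecialRung) :
    MaxContactCut.RungOne :=
  CuspX.closes (cuspGenericRung_of_engines hV hD hU hR hC hGE hSE hJE hX hXE hDXE hNE hOXE hCuE hTaE) hS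

end Corollaries

end Summit.ResolutionOfSingularities.ResolutionOfSingularities.Theorems.PinchTower
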